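import Summits.ResolutionOfSingularities.ResolutionOfSingularities.Theorems.WeightedInvariantIdealSheafLocalModels
import Literature.AlgebraicGeometry.Resolution.WeightedResolutionDatum
import HarnessLib

/-!
# Rees algebra data from AFFINE LOCAL MODELS: a graded family of glued ideal sheaves

[OURS · L1 W4.3 · DOOR `HypersurfaceCentreConstruction` (stmt-ResolutionOfSingularities-19897) · E2 CENTRE piece (C-c),
scheme hand (o47-c-scheme), steps (G-3)/(G-4) of the registrar's DESIGN MEMO `L/res-L1-w43-plan-1/E2-CENTRE-GLUE-DESIGN-v0.md`;
written by res-D-pv-048 (gen 11); companion of `…WeightedInvariantIdealSheafLocalModels` (one degree).  GENERIC scheme bookkeeping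
(no E2 vocabulary); def-free `∃`-statement; `--supports` the door item as a helper.  NOT a statement of [Hironaka2017]; folklore;
AI work, weaker than expert review.]

* `exists_reesAlgebraData_of_localModels` — on a quasi-separated scheme `Y`, finitely many affine opens `W_ℓ` carrying GRADED local
  models `I_ℓ : ℕ → Ideal Γ(Y, W_ℓ)` (`I_ℓ 0 = ⊤`, `I_ℓ m · I_ℓ n ≤ I_ℓ (m+n)`) that agree stalkwise on the overlaps in every degree, and
  whose zero loci stay inside the charted region (`closure (W_ℓ ∩ V(I_ℓ m)) ⊆ ⋃ W_ℓ'`), glue degree by degree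
  (`LocalModelSheaf.exists_idealSheafData_glue`) to a `ReesAlgebraData Y`: stalks `I_ℓ m · 𝒪_{Y,y}` on `W_ℓ`, `⊤` off `⋃ W_ℓ`,
  sections `R_m(W_ℓ) = I_ℓ m`, and degreewise maximality.  (`R₀ = ⊤` and `R_m R_n ≤ R_{m+n}` are checked on stalks:
  `ext_of_forall_stalkIdeal_eq`, `stalkIdeal_mul`.)
-/

noncomputable section

set_option linter.dupNamespace false

open CategoryTheory AlgebraicGeometry TopologicalSpace IsLocalRing
open Literature.AlgebraicGeometry.Resolution

universe u

namespace Summit.ResolutionOfSingularities.ResolutionOfSingularities.Theorems.LocalModelSheaf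

variable {Y : Scheme.{u}}

/-- **REES ALGEBRA DATA FROM GRADED AFFINE LOCAL MODELS** (see the module docstring). [folklore] -/
theorem exists_reesAlgebraData_of_localModels [QuasiSeparatedSpace Y] {L : Type} [Fintype L] (W : L → Y.affineOpens)
    (I : ∀ ℓ : L, ℕ → Ideal Γ(Y, W ℓ))
    (h0 : ∀ ℓ, I ℓ 0 = ⊤) (hmul : ∀ ℓ m n, I ℓ m * I ℓ n ≤ I ℓ (m + n))
    (hagree : ∀ (ℓ ℓ' : L) (m : ℕ) (y : Y) (h : y ∈ (W ℓ : Y.Opens)) (h' : y ∈ (W ℓ' : Y.Opens)),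
      (I ℓ m).map (Y.presheaf.germ (W ℓ : Y.Opens) y h).hom = (I ℓ' m).map (Y.presheaf.germ (W ℓ' : Y.Opens) y h').hom)
    (hcov : ∀ ℓ m, closure ((W ℓ : Set Y) ∩ Y.zeroLocus (U := (W ℓ : Y.Opens)) (I ℓ m : Set Γ(Y, W ℓ))) ⊆
      ⋃ ℓ', ((W ℓ' : Y.Opens) : Set Y)) :
    ∃ R : ReesAlgebraData Y,
      (∀ (ℓ : L) (m : ℕ) (y : Y) (hy : y ∈ (W ℓ : Y.Opens)),
        stalkIdeal (R.piece m) y = (I ℓ m).map (Y.presheaf.germ (W ℓ : Y.Opens) y hy).hom) ∧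
      (∀ (m : ℕ) (y : Y), (∀ ℓ, y ∉ (W ℓ : Y.Opens)) → stalkIdeal (R.piece m) y = ⊤) ∧
      (∀ ℓ m, (R.piece m).ideal (W ℓ) = I ℓ m) ∧
      ∀ (m : ℕ) (J : Y.IdealSheafData), (∀ ℓ, J.ideal (W ℓ) ≤ I ℓ m) → J ≤ R.piece m := by
  classical
  -- glue degree by degree
  choose R hRst hRtop hRsec hRmax using fun m : ℕ =>
    exists_idealSheafData_glue (Y := Y) W (fun ℓ => I ℓ m) (fun ℓ ℓ' y h h' => hagree ℓ ℓ' m y h h')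
  -- off the charted region every stalk is `⊤`
  have hoff : ∀ (m : ℕ) (y : Y), (∀ ℓ, y ∉ (W ℓ : Y.Opens)) → stalkIdeal (R m) y = ⊤ := by
    intro m y hy
    refine hRtop m y fun ℓ hmem => ?_
    obtain ⟨ℓ', hℓ'⟩ := Set.mem_iUnion.mp (hcov ℓ m hmem)
    exact hy ℓ' hℓ'
  -- every stalk: either a model stalk or `⊤`
  have hdich : ∀ (m : ℕ) (y : Y), (∃ (ℓ : L) (hy : y ∈ (W ℓ : Y.Opens)),
      stalkIdeal (R m) y = (I ℓ m).map (Y.presheaf.germ (W ℓ : Y.Opens) y hy).hom) ∨ stalkIdeal (R m) y = ⊤ := by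
    intro m y
    by_cases h : ∃ ℓ, y ∈ (W ℓ : Y.Opens)
    · obtain ⟨ℓ, hy⟩ := h
      exact Or.inl ⟨ℓ, hy, hRst m ℓ y hy⟩
    · push Not at h
      exact Or.inr (hoff m y h)
  refine ⟨{ piece := R, piece_zero := ?_, piece_mul_le := ?_ }, fun ℓ m y hy => hRst m ℓ y hy, hoff,
    fun ℓ m => hRsec m ℓ, fun m J hJ => hRmax m J hJ⟩
  · -- `R 0 = ⊤`, on stalks
    apply ext_of_forall_stalkIdeal_eq
    intro y
    rw [stalkIdeal_top]
    rcases hdich 0 y with ⟨ℓ, hy, h⟩ | h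
    · rw [h, h0 ℓ, Ideal.map_top]
    · exact h
  · -- `R m · R n ≤ R (m + n)`, on stalks
    intro m n
    refine le_of_forall_stalkIdeal_le fun y => ?_
    rw [stalkIdeal_mul]
    rcases hdich (m + n) y with ⟨ℓ, hy, h⟩ | h
    · rw [h, hRst m ℓ y hy, hRst n ℓ y hy, ← Ideal.map_mul]
      exact Ideal.map_mono (hmul ℓ m n)
    · rw [h]
      exact le_top

end Summit.ResolutionOfSingularities.ResolutionOfSingularities.Theorems.LocalModelSheaf

end
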